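import Summits.NavierStokesRegularity.FluidComputer.PalasekTowerBurgersNumberLevelZero
import Summits.NavierStokesRegularity.FluidComputer.PalasekTowerRegisterGlobalLetterField

/-!
# REGISTER v2.3′: the ANCHOR-LIMITED STRAIN CELL — a cell of strain `λA_k` carried by fluid of speed
# `≤ μY_k` is at most `2μ/(λN_k)` long (kinematic, N-3′ of STATUS l.3420 by name)

Cell `ns-blowup`, seat `ns-blowup-ecbridge-8` (g4); evidence toward the readout side of the cruxes
19179 `EpisodeBaseG` / 19249 / 19250 (route `PalasekTowerBreakdown`), companion of
`PalasekTowerCompactionBudget.lean` (the budget a child core needs) — here the first clause of the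
planner's N-3′ («ANCHOR-LIMITED CELL: strain `λA₀` from fluid of speed `≤ μY₀` needs half-wavelength
`L ≤ 2μY₀/(λA₀) = (2μ/λ)/N₀`»). LABEL: kinematic register arithmetic, one-dimensional mean-value
theorem along the stretching axis; the second clause of N-3′ (the viscous life `L²/(π²ν)` of the
lowest mode) is HEUR and is NOT typed here.

WHAT THIS IS NOT: not NS — a statement about ONE velocity component along ONE line: if
`∂_z u_z ≥ s` on a segment `[z₁, z₂]` of the axis and `|u_z| ≤ U` at its endpoints then
`s(z₂ − z₁) ≤ 2U` (`_strainCell_length_le`); in register units (`s = λA_k`, `U = μY_k`,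
`A_k = N_kY_k`, `TowerRates.A_eq_N_mul_Y`): `z₂ − z₁ ≤ 2μ/(λN_k)` (`_strainCell_length_register`; on the wide rates at `k = 0`,
`N₀ = 256`: `≤ μ/(128λ)`).

References: S. Palasek, arXiv:2605.13827, §3 (3.2) [cite: Palasek2026ElementaryModel, §3 (3.2)].
-/

namespace Summit.NavierStokesRegularity.FluidComputer.PalasekTowerClayBridge

open Real Set

/-- **A strain cell is anchor-limited (1-D mean value theorem)**: if `f` is differentiable with
`f' ≥ s` on `[z₁, z₂]` (`z₁ ≤ z₂`) and `|f| ≤ U` at the two endpoints, then `s · (z₂ − z₁) ≤ 2U`. -/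
theorem palasekTowerBreakdown_strainCell_length_le {f : ℝ → ℝ} {s U z₁ z₂ : ℝ} (hz : z₁ ≤ z₂)
    (hf : DifferentiableOn ℝ f (Icc z₁ z₂)) (hs : ∀ z ∈ Ioo z₁ z₂, s ≤ deriv f z)
    (h₁ : |f z₁| ≤ U) (h₂ : |f z₂| ≤ U) : s * (z₂ - z₁) ≤ 2 * U := by
  have hmvt := (convex_Icc z₁ z₂).mul_sub_le_image_sub_of_le_deriv hf.continuousOn
    (by rw [interior_Icc]; exact hf.mono Ioo_subset_Icc_self)
    (by rw [interior_Icc]; exact hs) z₁ (left_mem_Icc.2 hz) z₂ (right_mem_Icc.2 hz) hz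
  have h1 := (abs_le.1 h₁).1
  have h2 := (abs_le.1 h₂).2
  linarith

/-- **The anchor-limited strain cell in register units**: a segment of the stretching axis on which
the axial strain is at least `λA_k` (`λ > 0`), inside fluid whose axial speed is at most `μY_k` at the
segment's ends, is at most `2μ/(λN_k)` long. -/
theorem palasekTowerBreakdown_strainCell_length_register (R : TowerRates) (k : ℕ) {f : ℝ → ℝ}
    {l μ z₁ z₂ : ℝ} (hl : 0 < l) (hz : z₁ ≤ z₂) (hf : DifferentiableOn ℝ f (Icc z₁ z₂))
    (hs : ∀ z ∈ Ioo z₁ z₂, l * R.A k ≤ deriv f z)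
    (h₁ : |f z₁| ≤ μ * R.Y k) (h₂ : |f z₂| ≤ μ * R.Y k) :
    z₂ - z₁ ≤ 2 * μ / (l * R.N k) := by
  have h := palasekTowerBreakdown_strainCell_length_le hz hf hs h₁ h₂
  rw [R.A_eq_N_mul_Y k] at h
  have hN := R.N_pos k
  have hY : 0 < R.Y k := Real.rpow_pos_of_pos hN _
  rw [le_div_iff₀ (mul_pos hl hN)]
  -- `l N Y (z₂ − z₁) ≤ 2 μ Y`, divide by `Y > 0`
  have h' : (z₂ - z₁) * (l * R.N k) * R.Y k ≤ 2 * μ * R.Y k := by nlinarith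
  exact le_of_mul_le_mul_right h' hY

/-- **At level `0` on the wide rates** (`N₀ = 256`): the cell is at most `μ/(128λ)` long. -/
theorem palasekTowerBreakdown_strainCell_length_zero {f : ℝ → ℝ} {l μ z₁ z₂ : ℝ} (hl : 0 < l)
    (hz : z₁ ≤ z₂) (hf : DifferentiableOn ℝ f (Icc z₁ z₂))
    (hs : ∀ z ∈ Ioo z₁ z₂, l * TowerRates.wide.A 0 ≤ deriv f z)
    (h₁ : |f z₁| ≤ μ * TowerRates.wide.Y 0) (h₂ : |f z₂| ≤ μ * TowerRates.wide.Y 0) :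
    z₂ - z₁ ≤ μ / (128 * l) := by
  have h := palasekTowerBreakdown_strainCell_length_register TowerRates.wide 0 hl hz hf hs h₁ h₂
  rw [TowerRates.wide_N_zero] at h
  have e : 2 * μ / (l * 256) = μ / (128 * l) := by
    field_simp
    ring
  rwa [e] at h

end Summit.NavierStokesRegularity.FluidComputer.PalasekTowerClayBridge
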